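import Summits.QuantumFields.BalabanUV.T4Continuum.Support.RegionStarInjectedPairing

/-!
# T⁴ programme, spine node NE2 (U1a), sub-row Δ1 «NE2⁰-Dirichlet» — COMPOSITION BRICKS for the two-level commutator pairing (O14-b / O14-b′):
# sums of pairings, sums of budgets, and the ENERGY budget of a coercive propagator

Row NE2 OWNER (unit `b2b-balaban-t4-ne2-p1`, gen 14; R32 (d) / R33 (c), journal 2026-08-20 l.20841 / l.20955), file 2 of O14-b: BOOKKEEPING ONLY,
so that the located analytic item O14-b′ «W3-BOX-COMPRESSED» (the injected law of King's compressed planting `JpR` for the faithful `Δ_a(Ω₀)` on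
boxes) can be proved SUMMAND BY SUMMAND — (P-lap), (P-flux), (P-mass), (P-gauge) of R33 (c), each with its own budgets — and assembled into the
ONE pairing hypothesis of file 1's `RegionStarInjectedPairing.opNorm_injected_le_of_pairing` / `hinj_of_pairing`.

 * §1 **`pairing_add`**: pairings of `X₁`, `X₂` with constants `ε₁`, `ε₂` and budgets `(E₁,E₁′)`, `(E₂,E₂′)` give the pairing of `X₁ + X₂`
   with `ε₁ + ε₂` and the SUMMED budgets `(E₁+E₂, E₁′+E₂′)`; `pairing_sub`; `pairing_mono` (enlarging budgets / constants).
 * §2 **`budget_add`**: budget bounds `√Eᵢ(Tf) ≤ Λᵢ√nsq f` add: `√(E₁+E₂)(Tf) ≤ (Λ₁+Λ₂)√nsq f`.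
 * §3 **`energy_budget_of_coercive`**: for a Hermitian `γ`-coercive `D` (`γ > 0`), the ENERGY budget `E(u) = Re⟨u, Du⟩` of `u = D⁻¹f` obeys
   `√E(D⁻¹f) ≤ √(γ⁻¹)·√nsq f` — (R-energy) of R33 (c); on boxes `γ = γ_box` is a theorem (`RegionSliceCoerciveBox.coercive_regionDeltaA_box`):
   **`energy_budget_box`**.

HONEST FRAMING (T4-DAG p. 1).  [folklore] finite-dimensional bookkeeping; no analytic leaf of O14-b′ is proved here; model level (U = 1, one region,
one averaging scale, finite torus); NOT [B9] (3.16)/(3.23)–(3.27)/(3.42) as printed; NE2 (U1a) NOT proved; spine PROVED 0/9 unchanged; NOT infinite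
volume / mass gap / Clay.  HONEST DEPENDENCY: continuum YM on T⁴ ⇐ BetaPertH ∧ nine spine estimates (0/9 proved); BetaPertH ⇐ (D1) ∧ (D4) ∧ CAP+tail;
G-an2-4 gates asym, D1 and NE2/3/4.  No `sorry`.
-/

noncomputable section

open scoped BigOperators ComplexConjugate Matrix Matrix.Norms.L2Operator
open Finset

namespace Summit.QuantumFields.BalabanUV.T4Continuum.RegionStarPairingBricks

open Literature.MathematicalPhysics.QuantumFieldTheory.Balaban1983to89.B5Prop11Plancherel (Tor fine)
open Literature.MathematicalPhysics.QuantumFieldTheory.Balaban1983to89.B5Prop11Lower (nsq nsq_nonneg nsq_mulVec_le)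
open Summit.QuantumFields.BalabanUV.T4Continuum
open Summit.QuantumFields.BalabanUV.T4Continuum.SubtypeCompression (Coercive isUnit_det_of_coercive opNorm_inv_le_of_coercive)
open Summit.QuantumFields.BalabanUV.T4Continuum.ScalarAveragedPropagator (re_star_dotProduct_le gammaPs)
open Summit.QuantumFields.BalabanUV.T4Continuum.ScalarAveragedCompression (sigma0)
open Summit.QuantumFields.BalabanUV.T4Continuum.RegionGaugeOrbit (orbitConst)
open Summit.QuantumFields.BalabanUV.T4Continuum.RegionGaugeFixedVector (starReg regionDeltaA)
open Summit.QuantumFields.BalabanUV.T4Continuum.DirichletStarVectorTower (regionDeltaA_isHermitian)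
open Summit.QuantumFields.BalabanUV.T4Continuum.RegionSliceCoerciveBox (coercive_regionDeltaA_box)
open Summit.QuantumFields.BalabanUV.Beta.GAN24.DirichletBoxTwoLevel (IsCoordBox)

variable {d : ℕ}

/-! ## §1 Sums of pairings -/

section Pairing

variable {m m' : Type*} [Fintype m] [Fintype m']

/-- `√a ≤ √(a + b)` for `0 ≤ b`. [folklore] -/
theorem sqrt_le_sqrt_add {a b : ℝ} (hb : 0 ≤ b) : Real.sqrt a ≤ Real.sqrt (a + b) := Real.sqrt_le_sqrt (by linarith)

/-- **PAIRINGS ADD**: the pairing bound of `X₁ + X₂` with the summed constants and the summed budgets. [folklore] -/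
theorem pairing_add (X₁ X₂ : Matrix m' m ℂ) {E₁ E₂ : (m → ℂ) → ℝ} {E₁' E₂' : (m' → ℂ) → ℝ}
    (hE₁ : ∀ u, 0 ≤ E₁ u) (hE₂ : ∀ u, 0 ≤ E₂ u) (hE₁' : ∀ v, 0 ≤ E₁' v) (hE₂' : ∀ v, 0 ≤ E₂' v)
    {ε₁ ε₂ : ℝ} (hε₁ : 0 ≤ ε₁) (hε₂ : 0 ≤ ε₂)
    (h₁ : ∀ (u : m → ℂ) (v : m' → ℂ), ‖star v ⬝ᵥ (X₁ *ᵥ u)‖ ≤ ε₁ * Real.sqrt (E₁ u) * Real.sqrt (E₁' v))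
    (h₂ : ∀ (u : m → ℂ) (v : m' → ℂ), ‖star v ⬝ᵥ (X₂ *ᵥ u)‖ ≤ ε₂ * Real.sqrt (E₂ u) * Real.sqrt (E₂' v))
    (u : m → ℂ) (v : m' → ℂ) :
    ‖star v ⬝ᵥ ((X₁ + X₂) *ᵥ u)‖ ≤ (ε₁ + ε₂) * Real.sqrt (E₁ u + E₂ u) * Real.sqrt (E₁' v + E₂' v) := by
  rw [Matrix.add_mulVec, dotProduct_add]
  have ha := h₁ u v
  have hb := h₂ u v
  have s1 : Real.sqrt (E₁ u) ≤ Real.sqrt (E₁ u + E₂ u) := sqrt_le_sqrt_add (hE₂ u)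
  have s2 : Real.sqrt (E₂ u) ≤ Real.sqrt (E₁ u + E₂ u) := by rw [add_comm]; exact sqrt_le_sqrt_add (hE₁ u)
  have s3 : Real.sqrt (E₁' v) ≤ Real.sqrt (E₁' v + E₂' v) := sqrt_le_sqrt_add (hE₂' v)
  have s4 : Real.sqrt (E₂' v) ≤ Real.sqrt (E₁' v + E₂' v) := by rw [add_comm]; exact sqrt_le_sqrt_add (hE₁' v)
  have t1 : ε₁ * Real.sqrt (E₁ u) * Real.sqrt (E₁' v) ≤ ε₁ * Real.sqrt (E₁ u + E₂ u) * Real.sqrt (E₁' v + E₂' v) := by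
    gcongr
  have t2 : ε₂ * Real.sqrt (E₂ u) * Real.sqrt (E₂' v) ≤ ε₂ * Real.sqrt (E₁ u + E₂ u) * Real.sqrt (E₁' v + E₂' v) := by
    gcongr
  calc ‖star v ⬝ᵥ (X₁ *ᵥ u) + star v ⬝ᵥ (X₂ *ᵥ u)‖ ≤ ‖star v ⬝ᵥ (X₁ *ᵥ u)‖ + ‖star v ⬝ᵥ (X₂ *ᵥ u)‖ := norm_add_le _ _
    _ ≤ _ := by linarith

/-- **PAIRINGS SUBTRACT** (the commutator `JY − XJ` is a difference). [folklore] -/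
theorem pairing_sub (X₁ X₂ : Matrix m' m ℂ) {E₁ E₂ : (m → ℂ) → ℝ} {E₁' E₂' : (m' → ℂ) → ℝ}
    (hE₁ : ∀ u, 0 ≤ E₁ u) (hE₂ : ∀ u, 0 ≤ E₂ u) (hE₁' : ∀ v, 0 ≤ E₁' v) (hE₂' : ∀ v, 0 ≤ E₂' v)
    {ε₁ ε₂ : ℝ} (hε₁ : 0 ≤ ε₁) (hε₂ : 0 ≤ ε₂)
    (h₁ : ∀ (u : m → ℂ) (v : m' → ℂ), ‖star v ⬝ᵥ (X₁ *ᵥ u)‖ ≤ ε₁ * Real.sqrt (E₁ u) * Real.sqrt (E₁' v))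
    (h₂ : ∀ (u : m → ℂ) (v : m' → ℂ), ‖star v ⬝ᵥ (X₂ *ᵥ u)‖ ≤ ε₂ * Real.sqrt (E₂ u) * Real.sqrt (E₂' v))
    (u : m → ℂ) (v : m' → ℂ) :
    ‖star v ⬝ᵥ ((X₁ - X₂) *ᵥ u)‖ ≤ (ε₁ + ε₂) * Real.sqrt (E₁ u + E₂ u) * Real.sqrt (E₁' v + E₂' v) := by
  have h₂' : ∀ (u : m → ℂ) (v : m' → ℂ), ‖star v ⬝ᵥ ((-X₂) *ᵥ u)‖ ≤ ε₂ * Real.sqrt (E₂ u) * Real.sqrt (E₂' v) := by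
    intro u' v'
    rw [Matrix.neg_mulVec, dotProduct_neg, norm_neg]
    exact h₂ u' v'
  rw [sub_eq_add_neg]
  exact pairing_add X₁ (-X₂) hE₁ hE₂ hE₁' hE₂' hε₁ hε₂ h₁ h₂' u v

/-- **MONOTONICITY**: a pairing bound survives enlarging the constant and the budgets. [folklore] -/
theorem pairing_mono (X : Matrix m' m ℂ) {E F : (m → ℂ) → ℝ} {E' F' : (m' → ℂ) → ℝ} {ε η : ℝ} (hη : 0 ≤ η) (hεη : ε ≤ η)
    (hEF : ∀ u, E u ≤ F u) (hEF' : ∀ v, E' v ≤ F' v)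
    (h : ∀ (u : m → ℂ) (v : m' → ℂ), ‖star v ⬝ᵥ (X *ᵥ u)‖ ≤ ε * Real.sqrt (E u) * Real.sqrt (E' v))
    (u : m → ℂ) (v : m' → ℂ) :
    ‖star v ⬝ᵥ (X *ᵥ u)‖ ≤ η * Real.sqrt (F u) * Real.sqrt (F' v) := by
  have h1 := h u v
  have s1 : Real.sqrt (E u) ≤ Real.sqrt (F u) := Real.sqrt_le_sqrt (hEF u)
  have s2 : Real.sqrt (E' v) ≤ Real.sqrt (F' v) := Real.sqrt_le_sqrt (hEF' v)
  have hp : 0 ≤ Real.sqrt (E u) * Real.sqrt (E' v) := by positivity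
  calc ‖star v ⬝ᵥ (X *ᵥ u)‖ ≤ ε * Real.sqrt (E u) * Real.sqrt (E' v) := h1
    _ = ε * (Real.sqrt (E u) * Real.sqrt (E' v)) := by ring
    _ ≤ η * (Real.sqrt (E u) * Real.sqrt (E' v)) := mul_le_mul_of_nonneg_right hεη hp
    _ = η * Real.sqrt (E u) * Real.sqrt (E' v) := by ring
    _ ≤ η * Real.sqrt (F u) * Real.sqrt (F' v) := by gcongr

end Pairing

/-! ## §2 Sums of budgets -/

section Budget

variable {m k : Type*} [Fintype m] [Fintype k]

omit [Fintype m] in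
/-- **BUDGET BOUNDS ADD**: `√Eᵢ(Tf) ≤ Λᵢ·√nsq f` (`i = 1,2`) ⟹ `√(E₁+E₂)(Tf) ≤ (Λ₁+Λ₂)·√nsq f`. [folklore] -/
theorem budget_add {E₁ E₂ : (m → ℂ) → ℝ} (hE₁ : ∀ u, 0 ≤ E₁ u) (hE₂ : ∀ u, 0 ≤ E₂ u) (T : (k → ℂ) → (m → ℂ)) {Λ₁ Λ₂ : ℝ}
    (h₁ : ∀ f, Real.sqrt (E₁ (T f)) ≤ Λ₁ * Real.sqrt (nsq f)) (h₂ : ∀ f, Real.sqrt (E₂ (T f)) ≤ Λ₂ * Real.sqrt (nsq f)) (f : k → ℂ) :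
    Real.sqrt (E₁ (T f) + E₂ (T f)) ≤ (Λ₁ + Λ₂) * Real.sqrt (nsq f) := by
  have hs : Real.sqrt (E₁ (T f) + E₂ (T f)) ≤ Real.sqrt (E₁ (T f)) + Real.sqrt (E₂ (T f)) := by
    rw [Real.sqrt_le_left (by positivity)]
    have a := Real.sq_sqrt (hE₁ (T f)); have b := Real.sq_sqrt (hE₂ (T f))
    have c : 0 ≤ Real.sqrt (E₁ (T f)) * Real.sqrt (E₂ (T f)) := by positivity
    nlinarith
  have := h₁ f; have := h₂ f
  linarith

end Budget

/-! ## §3 The energy budget of a coercive Hermitian propagator -/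

section Energy

variable {m : Type*} [Fintype m] [DecidableEq m]

/-- **THE ENERGY BUDGET OF A COERCIVE PROPAGATOR**: for Hermitian `γ`-coercive `D` (`γ > 0`) and `u = D⁻¹f`,
`√(Re⟨u, Du⟩) = √(Re⟨D⁻¹f, f⟩) ≤ √(γ⁻¹)·√nsq f`. [folklore] -/
theorem energy_budget_of_coercive {D : Matrix m m ℂ} {γ : ℝ} (hγ : 0 < γ) (hco : Coercive D γ) (f : m → ℂ) :
    Real.sqrt ((star (D⁻¹ *ᵥ f) ⬝ᵥ (D *ᵥ (D⁻¹ *ᵥ f))).re) ≤ Real.sqrt γ⁻¹ * Real.sqrt (nsq f) := by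
  have hU := isUnit_det_of_coercive hγ hco
  have hG := opNorm_inv_le_of_coercive hγ hco
  rw [Matrix.mulVec_mulVec, Matrix.mul_nonsing_inv D hU, Matrix.one_mulVec]
  -- `Re⟨D⁻¹f, f⟩ ≤ √nsq(D⁻¹f)·√nsq f ≤ ‖D⁻¹‖·nsq f ≤ γ⁻¹·nsq f`
  have h1 := re_star_dotProduct_le (D⁻¹ *ᵥ f) f
  have h2 : Real.sqrt (nsq (D⁻¹ *ᵥ f)) ≤ ‖D⁻¹‖ * Real.sqrt (nsq f) := by
    rw [← Real.sqrt_sq (norm_nonneg D⁻¹), ← Real.sqrt_mul (sq_nonneg _)]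
    exact Real.sqrt_le_sqrt (nsq_mulVec_le D⁻¹ f)
  have h3 : (star (D⁻¹ *ᵥ f) ⬝ᵥ f).re ≤ γ⁻¹ * nsq f := by
    calc (star (D⁻¹ *ᵥ f) ⬝ᵥ f).re ≤ Real.sqrt (nsq (D⁻¹ *ᵥ f)) * Real.sqrt (nsq f) := h1
      _ ≤ ‖D⁻¹‖ * Real.sqrt (nsq f) * Real.sqrt (nsq f) := by gcongr
      _ = ‖D⁻¹‖ * nsq f := by rw [mul_assoc, Real.mul_self_sqrt (nsq_nonneg _)]
      _ ≤ γ⁻¹ * nsq f := mul_le_mul_of_nonneg_right hG (nsq_nonneg _)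
  rw [← Real.sqrt_mul (inv_nonneg.mpr hγ.le)]
  exact Real.sqrt_le_sqrt h3

end Energy

section Box

variable (n : ℕ) [NeZero n] (M : Fin d → ℕ) [hM : ∀ μ, NeZero (M μ)] (a a' : ℝ) (S : Tor M → Prop) [DecidablePred S]

/-- the W1 coercivity constant of `Δ_a(Ω₀)` on boxes (O14-a). [folklore] -/
def gamBox (d : ℕ) (a a' : ℝ) : ℝ := min (orbitConst d a (17 + 96 * 4) 96 / (1 + 4 * d / sigma0 d a') / 2) (1 / (2 * (gammaPs d a')⁻¹))

/-- **(R-energy) ON BOXES IS A THEOREM**: at every level `n ≥ 2`, on every coordinate box, the energy budget of `u = G(Ω₀)f` obeys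
`√(Re⟨u, Δ_a(Ω₀)u⟩) ≤ √(γ_box⁻¹)·√nsq f`, `γ_box = gamBox d a a′` free of `n`, `M`, the box. [folklore] -/
theorem energy_budget_box (hS : IsCoordBox M S) (hn : 2 ≤ n) (ha : 0 < a) (ha' : 0 < a') (hγ : 0 < gamBox d a a')
    (f : {b // starReg n M S b} → ℂ) :
    Real.sqrt ((star ((regionDeltaA n M a a' S)⁻¹ *ᵥ f) ⬝ᵥ (regionDeltaA n M a a' S *ᵥ ((regionDeltaA n M a a' S)⁻¹ *ᵥ f))).re)
      ≤ Real.sqrt (gamBox d a a')⁻¹ * Real.sqrt (nsq f) :=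
  energy_budget_of_coercive hγ (coercive_regionDeltaA_box n M a a' S hS hn ha ha') f

end Box

end Summit.QuantumFields.BalabanUV.T4Continuum.RegionStarPairingBricks

end
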